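import Summits.CriticalPhenomena.CardyFormulaZ2.Theorems.CardyBoundaryCoulombGasStripClusterRatesCgTwoCluster
import Summits.CriticalPhenomena.CardyFormulaZ2.Theorems.CardyBoundaryCoulombGasStripClusterRatesCgGluePlus
import Summits.CriticalPhenomena.CardyFormulaZ2.Theorems.CardyBoundaryCoulombGasStripClusterRatesCgGlueMinus
import Summits.CriticalPhenomena.CardyFormulaZ2.Theorems.CardyBoundaryCoulombGasStripClusterRatesCgGlueIndep
import Summits.CriticalPhenomena.CardyFormulaZ2.Theorems.CardyBoundaryCoulombGasStripClusterRatesCgGlueLocal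
import Summits.CriticalPhenomena.CardyFormulaZ2.Theorems.CardyBoundaryCoulombGasStripClusterRatesCgRate
import Summits.CriticalPhenomena.CardyFormulaZ2.Theorems.CardyBoundaryCoulombGasStripClusterRatesTwoClusterCardyOrderLiminf
import Summits.CriticalPhenomena.CardyFormulaZ2.Theorems.CardyBoundaryCoulombGasStripClusterRatesTwoClusterMonotone
import Summits.CriticalPhenomena.CardyFormulaZ2.Theorems.CardyBoundaryCoulombGasStripClusterRatesTwoClusterKacIffKacTwo
import Summits.CriticalPhenomena.CardyFormulaZ2.Theorems.CardyBoundaryCoulombGasStripClusterRatesOfCardyRectangle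
import Summits.CriticalPhenomena.CardyFormulaZ2.Theorems.CardyBoundaryCoulombGasStripClusterRatesOfCardyFormulaZ2
import Literature.Probability.Percolation.RSW

/-!
# The γ₂-half of `StripClusterRates` by ORDER TRANSFER through end-confined gluing (reshape 5, lead c6)

Support file for line `two-cluster-rate-is-stationary-gap` (crux `StripClusterRates`, stmt-CriticalPhenomena-13878). This is the
kernel-checked composition of reshape 5: the transfer-matrix-order open core K₂ (`n·(−log SLEM of the unmarked planar row chain) → 2π`)
is DERIVED from the CARDY-ORDER two-cluster Kac statement CO₂ (`h_{1,5} = 2` for the `A × 1` rectangle as the mesh → 0, two-sided: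
the plain two-cluster event from above, the END-CONFINED three-arm event from below), with all lattice and order-of-limits work
proved:

* §1 `cg_f_supermul`: the probability `f(M,b)` of the end-confined block event (two confined open long crossings of
  `[0,M]×[0,3b+2]` + fences, and a confined dual-open long face crossing) is SUPER-MULTIPLICATIVE up to an absolute constant:
  `c·f(M₁,b)·f(M₂,b) ≤ f(M₁+b+2+M₂,b)` (`b ≥ 3`; glue = RSW crossings of three boxes at the junction, Nolin's generalised FKG;
  landed stubs `stub_cgGluePlus`, `stub_cgGlueMinus`, `stub_cgGlueIndep`, `stub_cgGlueLocal`);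
  `cg_f_le_pTwo`: `f ≤ p₂` (landed stub `stub_cgTwoCluster`: the structure has two spanning clusters, by transposed planar duality);
* §2 `cg_rateTwo_le_confined`: hence `γ₂(3b+2) ≤ (−log f(M,b) − log c)/(M+b+2)` for every `M ≥ b+1` (landed `cg_rate_le_of_supermul`);
* §3 `tendsto_nMul_rateTwo_of_cardyOrderTwo`: CO₂ ⇒ `n·γ₂(n) → 2π` for EVERY family of two-cluster rates (limsup through §2 at
  `M = A(3b+2)` + antitonicity of `γ₂` in the width for the widths `≢ 2 (mod 3)`; liminf by sub-multiplicativity, c5);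
  `kacTwo_of_cardyOrderTwo`: CO₂ ⇒ K₂ (`twoClusterKac_iff_kacTwo`);
* §4 `stripClusterRates_of_cardyRectangle_of_cardyOrderTwo` / `…_of_cardyFormulaZ2_…`: the crux from `CardyRectangle`
  (stmt-CriticalPhenomena-4782) resp. the conjunct, and CO₂ — everything in `StripClusterRates` beyond Cardy-order conformal-invariance
  statements is lattice work done here; no quasi-multiplicativity / arm separation of `p₂` is needed.

References: [Cardy1998] eq. (bb) (`n = 2`); [Nolin2008] §4.3 Lemma 13; [BollobasRiordan2006] Ch. 3; [Aizenman1997] Thm 3.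
-/

noncomputable section

open MeasureTheory Filter Topology Set
open Literature.Probability.LatticeModels Literature.Probability.Percolation
open Summit.CriticalPhenomena.CardyFormulaZ2.Theorems.StripClusterRates.Negative (pTwo rateSeqTwo)

namespace Summit.CriticalPhenomena.CardyFormulaZ2.Cruxes.StripClusterRates.TwoClusterRateIsStationaryGap

/-! ## §1 Super-multiplicativity of the confined block probability and `f ≤ p₂` -/

/-- **`f` is super-multiplicative up to an absolute constant** (`f(M,b)` = probability of the end-confined block event):
`c · f(M₁,b) · f(M₂,b) ≤ f(M₁+b+2+M₂, b)` for `b ≥ 3`, `M₁, M₂ ≥ b+1`. [cite: Nolin2008, §4.3 Lemma 13] -/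
theorem cg_f_supermul : ∃ c : ℝ, 0 < c ∧ c ≤ 1 ∧ ∀ f : ℕ → ℕ → ℝ,
    f = (fun M b : ℕ => (bondPercolation (zdGraph 2) half).real ((openCrossing {z ∈ (rectangle M (3 * b + 2) : Set (Site 2)) | (z 0 ≤ (b : ℤ) ∨ (M : ℤ) ≤ z 0 + b) → z 1 ≤ (b : ℤ)} (leftSide M (3 * b + 2) : Set (Site 2)) (rightSide M (3 * b + 2) : Set (Site 2)) ∩ tbCrossing b b ∩ openCrossing {z ∈ (rectangle M (3 * b + 2) : Set (Site 2)) | (z 0 ≤ (b : ℤ) ∨ (M : ℤ) ≤ z 0 + b) → 2 * (b : ℤ) + 2 ≤ z 1} (leftSide M (3 * b + 2) : Set (Site 2)) (rightSide M (3 * b + 2) : Set (Site 2)) ∩ (BondConfig.relabel (sym2Equiv (Site.shift (-pt 0 (2 * (b : ℤ) + 2))))) ⁻¹' tbCrossing b b) ∩ (dualConfig ⁻¹' openCrossing {z ∈ ((· + pt (-1) 0) '' (rectangle (M + 1) (3 * b + 1) : Set (Site 2))) | (z 0 ≤ (b : ℤ) ∨ (M : ℤ) ≤ z 0 + b) → (b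 : ℤ) + 1 ≤ z 1 ∧ z 1 ≤ 2 * (b : ℤ)} ((· + pt (-1) 0) '' (leftSide (M + 1) (3 * b + 1) : Set (Site 2))) ((· + pt (-1) 0) '' (rightSide (M + 1) (3 * b + 1) : Set (Site 2)))))) →
    ∀ (M₁ M₂ b : ℕ), 3 ≤ b → b + 1 ≤ M₁ → b + 1 ≤ M₂ → c * f M₁ b * f M₂ b ≤ f (M₁ + b + 2 + M₂) b := by
  obtain ⟨c, hc, hloc⟩ := stub_cgGlueLocal
  refine ⟨min c 1, lt_min hc one_pos, min_le_right _ _, fun f hf M₁ M₂ b hb hM₁ hM₂ => ?_⟩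
  subst hf
  show min c 1 * (bondPercolation (zdGraph 2) half).real ((openCrossing {z ∈ (rectangle M₁ (3 * b + 2) : Set (Site 2)) | (z 0 ≤ (b : ℤ) ∨ (M₁ : ℤ) ≤ z 0 + b) → z 1 ≤ (b : ℤ)} (leftSide M₁ (3 * b + 2) : Set (Site 2)) (rightSide M₁ (3 * b + 2) : Set (Site 2)) ∩ tbCrossing b b ∩ openCrossing {z ∈ (rectangle M₁ (3 * b + 2) : Set (Site 2)) | (z 0 ≤ (b : ℤ) ∨ (M₁ : ℤ) ≤ z 0 + b) → 2 * (b : ℤ) + 2 ≤ z 1} (leftSide M₁ (3 * b + 2) : Set (Site 2)) (rightSide M₁ (3 * b + 2) : Set (Site 2)) ∩ (BondConfig.relabel (sym2Equiv (Site.shift (-pt 0 (2 * (b : ℤ) + 2))))) ⁻¹' tbCrossing b b) ∩ (dualConfig ⁻¹' openCrossing {z ∈ ((· + pt (-1) 0) '' (rectangle (M₁ + 1) (3 * b + 1) : Set (Site 2))) | (z 0 ≤ (b : ℤ) ∨ (M₁ : ℤ) ≤ z 0 + b) → (b : ℤ) + 1 ≤ z 1 ∧ z 1 ≤ 2 * (b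 : ℤ)} ((· + pt (-1) 0) '' (leftSide (M₁ + 1) (3 * b + 1) : Set (Site 2))) ((· + pt (-1) 0) '' (rightSide (M₁ + 1) (3 * b + 1) : Set (Site 2))))) * (bondPercolation (zdGraph 2) half).real ((openCrossing {z ∈ (rectangle M₂ (3 * b + 2) : Set (Site 2)) | (z 0 ≤ (b : ℤ) ∨ (M₂ : ℤ) ≤ z 0 + b) → z 1 ≤ (b : ℤ)} (leftSide M₂ (3 * b + 2) : Set (Site 2)) (rightSide M₂ (3 * b + 2) : Set (Site 2)) ∩ tbCrossing b b ∩ openCrossing {z ∈ (rectangle M₂ (3 * b + 2) : Set (Site 2)) | (z 0 ≤ (b : ℤ) ∨ (M₂ : ℤ) ≤ z 0 + b) → 2 * (b : ℤ) + 2 ≤ z 1} (leftSide M₂ (3 * b + 2) : Set (Site 2)) (rightSide M₂ (3 * b + 2) : Set (Site 2)) ∩ (BondConfig.relabel (sym2Equiv (Site.shift (-pt 0 (2 * (b : ℤ) + 2))))) ⁻¹' tbCrossing b b) ∩ (dualConfig ⁻¹' openCrossing {z ∈ ((· + pt (-1) 0) '' (rectangle (M₂ + 1) (3 * b + 1) :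 Set (Site 2))) | (z 0 ≤ (b : ℤ) ∨ (M₂ : ℤ) ≤ z 0 + b) → (b : ℤ) + 1 ≤ z 1 ∧ z 1 ≤ 2 * (b : ℤ)} ((· + pt (-1) 0) '' (leftSide (M₂ + 1) (3 * b + 1) : Set (Site 2))) ((· + pt (-1) 0) '' (rightSide (M₂ + 1) (3 * b + 1) : Set (Site 2))))) ≤ (bondPercolation (zdGraph 2) half).real ((openCrossing {z ∈ (rectangle (M₁ + b + 2 + M₂ : ℕ) (3 * b + 2) : Set (Site 2)) | (z 0 ≤ (b : ℤ) ∨ ((M₁ + b + 2 + M₂ : ℕ) : ℤ) ≤ z 0 + b) → z 1 ≤ (b : ℤ)} (leftSide (M₁ + b + 2 + M₂ : ℕ) (3 * b + 2) : Set (Site 2)) (rightSide (M₁ + b + 2 + M₂ : ℕ) (3 * b + 2) : Set (Site 2)) ∩ tbCrossing b b ∩ openCrossing {z ∈ (rectangle (M₁ + b + 2 + M₂ : ℕ) (3 * b + 2) : Set (Site 2)) | (z 0 ≤ (b : ℤ) ∨ ((M₁ + b + 2 + M₂ : ℕ) : ℤ) ≤ z 0 + b) → 2 * (b : ℤ) +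 2 ≤ z 1} (leftSide (M₁ + b + 2 + M₂ : ℕ) (3 * b + 2) : Set (Site 2)) (rightSide (M₁ + b + 2 + M₂ : ℕ) (3 * b + 2) : Set (Site 2)) ∩ (BondConfig.relabel (sym2Equiv (Site.shift (-pt 0 (2 * (b : ℤ) + 2))))) ⁻¹' tbCrossing b b) ∩ (dualConfig ⁻¹' openCrossing {z ∈ ((· + pt (-1) 0) '' (rectangle ((M₁ + b + 2 + M₂ : ℕ) + 1) (3 * b + 1) : Set (Site 2))) | (z 0 ≤ (b : ℤ) ∨ ((M₁ + b + 2 + M₂ : ℕ) : ℤ) ≤ z 0 + b) → (b : ℤ) + 1 ≤ z 1 ∧ z 1 ≤ 2 * (b : ℤ)} ((· + pt (-1) 0) '' (leftSide ((M₁ + b + 2 + M₂ : ℕ) + 1) (3 * b + 1) : Set (Site 2))) ((· + pt (-1) 0) '' (rightSide ((M₁ + b + 2 + M₂ : ℕ) + 1) (3 * b + 1) : Set (Site 2)))))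
  have hb1 : 1 ≤ b := le_trans (by norm_num) hb
  have hind : (bondPercolation (zdGraph 2) half).real (((openCrossing {z ∈ (rectangle M₁ (3 * b + 2) : Set (Site 2)) | (z 0 ≤ (b : ℤ) ∨ (M₁ : ℤ) ≤ z 0 + b) → z 1 ≤ (b : ℤ)} (leftSide M₁ (3 * b + 2) : Set (Site 2)) (rightSide M₁ (3 * b + 2) : Set (Site 2)) ∩ tbCrossing b b ∩ openCrossing {z ∈ (rectangle M₁ (3 * b + 2) : Set (Site 2)) | (z 0 ≤ (b : ℤ) ∨ (M₁ : ℤ) ≤ z 0 + b) → 2 * (b : ℤ) + 2 ≤ z 1} (leftSide M₁ (3 * b + 2) : Set (Site 2)) (rightSide M₁ (3 * b + 2) : Set (Site 2)) ∩ (BondConfig.relabel (sym2Equiv (Site.shift (-pt 0 (2 * (b : ℤ) + 2))))) ⁻¹' tbCrossing b b) ∩ (dualConfig ⁻¹' openCrossing {z ∈ ((· + pt (-1) 0) '' (rectangle (M₁ + 1) (3 * b + 1) : Set (Site 2))) | (z 0 ≤ (b : ℤ) ∨ (M₁ : ℤ) ≤ z 0 + b) → (b : ℤ) + 1 ≤ z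 1 ∧ z 1 ≤ 2 * (b : ℤ)} ((· + pt (-1) 0) '' (leftSide (M₁ + 1) (3 * b + 1) : Set (Site 2))) ((· + pt (-1) 0) '' (rightSide (M₁ + 1) (3 * b + 1) : Set (Site 2))))) ∩ (BondConfig.relabel (sym2Equiv (Site.shift (-pt ((M₁ : ℤ) + b + 2) 0)))) ⁻¹' ((openCrossing {z ∈ (rectangle M₂ (3 * b + 2) : Set (Site 2)) | (z 0 ≤ (b : ℤ) ∨ (M₂ : ℤ) ≤ z 0 + b) → z 1 ≤ (b : ℤ)} (leftSide M₂ (3 * b + 2) : Set (Site 2)) (rightSide M₂ (3 * b + 2) : Set (Site 2)) ∩ tbCrossing b b ∩ openCrossing {z ∈ (rectangle M₂ (3 * b + 2) : Set (Site 2)) | (z 0 ≤ (b : ℤ) ∨ (M₂ : ℤ) ≤ z 0 + b) → 2 * (b : ℤ) + 2 ≤ z 1} (leftSide M₂ (3 * b + 2) : Set (Site 2)) (rightSide M₂ (3 * b + 2) : Set (Site 2)) ∩ (BondConfig.relabel (sym2Equiv (Site.shift (-pt 0 (2 * (b : ℤ) + 2))))) ⁻¹' tbCrossing b b) ∩ (dualConfig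 ⁻¹' openCrossing {z ∈ ((· + pt (-1) 0) '' (rectangle (M₂ + 1) (3 * b + 1) : Set (Site 2))) | (z 0 ≤ (b : ℤ) ∨ (M₂ : ℤ) ≤ z 0 + b) → (b : ℤ) + 1 ≤ z 1 ∧ z 1 ≤ 2 * (b : ℤ)} ((· + pt (-1) 0) '' (leftSide (M₂ + 1) (3 * b + 1) : Set (Site 2))) ((· + pt (-1) 0) '' (rightSide (M₂ + 1) (3 * b + 1) : Set (Site 2)))))) = (bondPercolation (zdGraph 2) half).real ((openCrossing {z ∈ (rectangle M₁ (3 * b + 2) : Set (Site 2)) | (z 0 ≤ (b : ℤ) ∨ (M₁ : ℤ) ≤ z 0 + b) → z 1 ≤ (b : ℤ)} (leftSide M₁ (3 * b + 2) : Set (Site 2)) (rightSide M₁ (3 * b + 2) : Set (Site 2)) ∩ tbCrossing b b ∩ openCrossing {z ∈ (rectangle M₁ (3 * b + 2) : Set (Site 2)) | (z 0 ≤ (b : ℤ) ∨ (M₁ : ℤ) ≤ z 0 + b) → 2 * (b : ℤ) + 2 ≤ z 1} (leftSide M₁ (3 * b + 2) : Set (Site 2)) (rightSide M₁ (3 * b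 + 2) : Set (Site 2)) ∩ (BondConfig.relabel (sym2Equiv (Site.shift (-pt 0 (2 * (b : ℤ) + 2))))) ⁻¹' tbCrossing b b) ∩ (dualConfig ⁻¹' openCrossing {z ∈ ((· + pt (-1) 0) '' (rectangle (M₁ + 1) (3 * b + 1) : Set (Site 2))) | (z 0 ≤ (b : ℤ) ∨ (M₁ : ℤ) ≤ z 0 + b) → (b : ℤ) + 1 ≤ z 1 ∧ z 1 ≤ 2 * (b : ℤ)} ((· + pt (-1) 0) '' (leftSide (M₁ + 1) (3 * b + 1) : Set (Site 2))) ((· + pt (-1) 0) '' (rightSide (M₁ + 1) (3 * b + 1) : Set (Site 2))))) * (bondPercolation (zdGraph 2) half).real ((openCrossing {z ∈ (rectangle M₂ (3 * b + 2) : Set (Site 2)) | (z 0 ≤ (b : ℤ) ∨ (M₂ : ℤ) ≤ z 0 + b) → z 1 ≤ (b : ℤ)} (leftSide M₂ (3 * b + 2) : Set (Site 2)) (rightSide M₂ (3 * b + 2) : Set (Site 2)) ∩ tbCrossing b b ∩ openCrossing {z ∈ (rectangle M₂ (3 * b + 2) : Set (Site 2)) | (z 0 ≤ (b : ℤ) ∨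 (M₂ : ℤ) ≤ z 0 + b) → 2 * (b : ℤ) + 2 ≤ z 1} (leftSide M₂ (3 * b + 2) : Set (Site 2)) (rightSide M₂ (3 * b + 2) : Set (Site 2)) ∩ (BondConfig.relabel (sym2Equiv (Site.shift (-pt 0 (2 * (b : ℤ) + 2))))) ⁻¹' tbCrossing b b) ∩ (dualConfig ⁻¹' openCrossing {z ∈ ((· + pt (-1) 0) '' (rectangle (M₂ + 1) (3 * b + 1) : Set (Site 2))) | (z 0 ≤ (b : ℤ) ∨ (M₂ : ℤ) ≤ z 0 + b) → (b : ℤ) + 1 ≤ z 1 ∧ z 1 ≤ 2 * (b : ℤ)} ((· + pt (-1) 0) '' (leftSide (M₂ + 1) (3 * b + 1) : Set (Site 2))) ((· + pt (-1) 0) '' (rightSide (M₂ + 1) (3 * b + 1) : Set (Site 2))))) :=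
    stub_cgGlueIndep M₁ M₂ b hb1 _ _ rfl rfl
  have hl : c * (bondPercolation (zdGraph 2) half).real (((openCrossing {z ∈ (rectangle M₁ (3 * b + 2) : Set (Site 2)) | (z 0 ≤ (b : ℤ) ∨ (M₁ : ℤ) ≤ z 0 + b) → z 1 ≤ (b : ℤ)} (leftSide M₁ (3 * b + 2) : Set (Site 2)) (rightSide M₁ (3 * b + 2) : Set (Site 2)) ∩ tbCrossing b b ∩ openCrossing {z ∈ (rectangle M₁ (3 * b + 2) : Set (Site 2)) | (z 0 ≤ (b : ℤ) ∨ (M₁ : ℤ) ≤ z 0 + b) → 2 * (b : ℤ) + 2 ≤ z 1} (leftSide M₁ (3 * b + 2) : Set (Site 2)) (rightSide M₁ (3 * b + 2) : Set (Site 2)) ∩ (BondConfig.relabel (sym2Equiv (Site.shift (-pt 0 (2 * (b : ℤ) + 2))))) ⁻¹' tbCrossing b b) ∩ (dualConfig ⁻¹' openCrossing {z ∈ ((· + pt (-1) 0) '' (rectangle (M₁ + 1) (3 * b + 1) : Set (Site 2))) | (z 0 ≤ (b : ℤ) ∨ (M₁ : ℤ) ≤ z 0 + b) → (b : ℤ)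 + 1 ≤ z 1 ∧ z 1 ≤ 2 * (b : ℤ)} ((· + pt (-1) 0) '' (leftSide (M₁ + 1) (3 * b + 1) : Set (Site 2))) ((· + pt (-1) 0) '' (rightSide (M₁ + 1) (3 * b + 1) : Set (Site 2))))) ∩ (BondConfig.relabel (sym2Equiv (Site.shift (-pt ((M₁ : ℤ) + b + 2) 0)))) ⁻¹' ((openCrossing {z ∈ (rectangle M₂ (3 * b + 2) : Set (Site 2)) | (z 0 ≤ (b : ℤ) ∨ (M₂ : ℤ) ≤ z 0 + b) → z 1 ≤ (b : ℤ)} (leftSide M₂ (3 * b + 2) : Set (Site 2)) (rightSide M₂ (3 * b + 2) : Set (Site 2)) ∩ tbCrossing b b ∩ openCrossing {z ∈ (rectangle M₂ (3 * b + 2) : Set (Site 2)) | (z 0 ≤ (b : ℤ) ∨ (M₂ : ℤ) ≤ z 0 + b) → 2 * (b : ℤ) + 2 ≤ z 1} (leftSide M₂ (3 * b + 2) : Set (Site 2)) (rightSide M₂ (3 * b + 2) : Set (Site 2)) ∩ (BondConfig.relabel (sym2Equiv (Site.shift (-pt 0 (2 * (b : ℤ) + 2))))) ⁻¹' tbCrossing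 b b) ∩ (dualConfig ⁻¹' openCrossing {z ∈ ((· + pt (-1) 0) '' (rectangle (M₂ + 1) (3 * b + 1) : Set (Site 2))) | (z 0 ≤ (b : ℤ) ∨ (M₂ : ℤ) ≤ z 0 + b) → (b : ℤ) + 1 ≤ z 1 ∧ z 1 ≤ 2 * (b : ℤ)} ((· + pt (-1) 0) '' (leftSide (M₂ + 1) (3 * b + 1) : Set (Site 2))) ((· + pt (-1) 0) '' (rightSide (M₂ + 1) (3 * b + 1) : Set (Site 2)))))) ≤
      (bondPercolation (zdGraph 2) half).real (((openCrossing {z ∈ (rectangle M₁ (3 * b + 2) : Set (Site 2)) | (z 0 ≤ (b : ℤ) ∨ (M₁ : ℤ) ≤ z 0 + b) → z 1 ≤ (b : ℤ)} (leftSide M₁ (3 * b + 2) : Set (Site 2)) (rightSide M₁ (3 * b + 2) : Set (Site 2)) ∩ tbCrossing b b ∩ openCrossing {z ∈ (rectangle M₁ (3 * b + 2) : Set (Site 2)) | (z 0 ≤ (b : ℤ) ∨ (M₁ : ℤ) ≤ z 0 + b) → 2 * (b : ℤ) + 2 ≤ z 1} (leftSide M₁ (3 * b + 2) : Set (Site 2))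 (rightSide M₁ (3 * b + 2) : Set (Site 2)) ∩ (BondConfig.relabel (sym2Equiv (Site.shift (-pt 0 (2 * (b : ℤ) + 2))))) ⁻¹' tbCrossing b b) ∩ (dualConfig ⁻¹' openCrossing {z ∈ ((· + pt (-1) 0) '' (rectangle (M₁ + 1) (3 * b + 1) : Set (Site 2))) | (z 0 ≤ (b : ℤ) ∨ (M₁ : ℤ) ≤ z 0 + b) → (b : ℤ) + 1 ≤ z 1 ∧ z 1 ≤ 2 * (b : ℤ)} ((· + pt (-1) 0) '' (leftSide (M₁ + 1) (3 * b + 1) : Set (Site 2))) ((· + pt (-1) 0) '' (rightSide (M₁ + 1) (3 * b + 1) : Set (Site 2))))) ∩ (BondConfig.relabel (sym2Equiv (Site.shift (-pt ((M₁ : ℤ) + b + 2) 0)))) ⁻¹' ((openCrossing {z ∈ (rectangle M₂ (3 * b + 2) : Set (Site 2)) | (z 0 ≤ (b : ℤ) ∨ (M₂ : ℤ) ≤ z 0 + b) → z 1 ≤ (b : ℤ)} (leftSide M₂ (3 * b + 2) : Set (Site 2)) (rightSide M₂ (3 * b + 2) : Set (Site 2)) ∩ tbCrossing b b ∩ openCrossing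 {z ∈ (rectangle M₂ (3 * b + 2) : Set (Site 2)) | (z 0 ≤ (b : ℤ) ∨ (M₂ : ℤ) ≤ z 0 + b) → 2 * (b : ℤ) + 2 ≤ z 1} (leftSide M₂ (3 * b + 2) : Set (Site 2)) (rightSide M₂ (3 * b + 2) : Set (Site 2)) ∩ (BondConfig.relabel (sym2Equiv (Site.shift (-pt 0 (2 * (b : ℤ) + 2))))) ⁻¹' tbCrossing b b) ∩ (dualConfig ⁻¹' openCrossing {z ∈ ((· + pt (-1) 0) '' (rectangle (M₂ + 1) (3 * b + 1) : Set (Site 2))) | (z 0 ≤ (b : ℤ) ∨ (M₂ : ℤ) ≤ z 0 + b) → (b : ℤ) + 1 ≤ z 1 ∧ z 1 ≤ 2 * (b : ℤ)} ((· + pt (-1) 0) '' (leftSide (M₂ + 1) (3 * b + 1) : Set (Site 2))) ((· + pt (-1) 0) '' (rightSide (M₂ + 1) (3 * b + 1) : Set (Site 2))))) ∩ (lrCrossingAt (pt ((M₁ : ℤ) - b) 0) (3 * b + 2) b ∩ (BondConfig.relabel (sym2Equiv (Site.shift (-pt ((M₁ : ℤ) - b) 0)))) ⁻¹' tbCrossing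 b b ∩ (BondConfig.relabel (sym2Equiv (Site.shift (-pt ((M₁ : ℤ) + b + 2) 0)))) ⁻¹' tbCrossing b b ∩ lrCrossingAt (pt ((M₁ : ℤ) - b) (2 * (b : ℤ) + 2)) (3 * b + 2) b ∩ (BondConfig.relabel (sym2Equiv (Site.shift (-pt ((M₁ : ℤ) - b) (2 * (b : ℤ) + 2))))) ⁻¹' tbCrossing b b ∩ (BondConfig.relabel (sym2Equiv (Site.shift (-pt ((M₁ : ℤ) + b + 2) (2 * (b : ℤ) + 2))))) ⁻¹' tbCrossing b b) ∩ (dualConfig ⁻¹' (lrCrossingAt (pt ((M₁ : ℤ) - b) ((b : ℤ) + 1)) (3 * b + 2) (b - 1) ∩ (BondConfig.relabel (sym2Equiv (Site.shift (-pt ((M₁ : ℤ) - b) ((b : ℤ) + 1))))) ⁻¹' tbCrossing b (b - 1) ∩ (BondConfig.relabel (sym2Equiv (Site.shift (-pt ((M₁ : ℤ) + b + 1) ((b : ℤ) + 1))))) ⁻¹' tbCrossing (b + 1) (b - 1)))) :=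
    hloc M₁ M₂ b hb hM₁ hM₂ _ _ rfl rfl
  have hsub : (bondPercolation (zdGraph 2) half).real (((openCrossing {z ∈ (rectangle M₁ (3 * b + 2) : Set (Site 2)) | (z 0 ≤ (b : ℤ) ∨ (M₁ : ℤ) ≤ z 0 + b) → z 1 ≤ (b : ℤ)} (leftSide M₁ (3 * b + 2) : Set (Site 2)) (rightSide M₁ (3 * b + 2) : Set (Site 2)) ∩ tbCrossing b b ∩ openCrossing {z ∈ (rectangle M₁ (3 * b + 2) : Set (Site 2)) | (z 0 ≤ (b : ℤ) ∨ (M₁ : ℤ) ≤ z 0 + b) → 2 * (b : ℤ) + 2 ≤ z 1} (leftSide M₁ (3 * b + 2) : Set (Site 2)) (rightSide M₁ (3 * b + 2) : Set (Site 2)) ∩ (BondConfig.relabel (sym2Equiv (Site.shift (-pt 0 (2 * (b : ℤ) + 2))))) ⁻¹' tbCrossing b b) ∩ (dualConfig ⁻¹' openCrossing {z ∈ ((· + pt (-1) 0) '' (rectangle (M₁ + 1) (3 * b + 1) : Set (Site 2))) | (z 0 ≤ (b : ℤ) ∨ (M₁ : ℤ) ≤ z 0 + b) → (b : ℤ) +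 1 ≤ z 1 ∧ z 1 ≤ 2 * (b : ℤ)} ((· + pt (-1) 0) '' (leftSide (M₁ + 1) (3 * b + 1) : Set (Site 2))) ((· + pt (-1) 0) '' (rightSide (M₁ + 1) (3 * b + 1) : Set (Site 2))))) ∩ (BondConfig.relabel (sym2Equiv (Site.shift (-pt ((M₁ : ℤ) + b + 2) 0)))) ⁻¹' ((openCrossing {z ∈ (rectangle M₂ (3 * b + 2) : Set (Site 2)) | (z 0 ≤ (b : ℤ) ∨ (M₂ : ℤ) ≤ z 0 + b) → z 1 ≤ (b : ℤ)} (leftSide M₂ (3 * b + 2) : Set (Site 2)) (rightSide M₂ (3 * b + 2) : Set (Site 2)) ∩ tbCrossing b b ∩ openCrossing {z ∈ (rectangle M₂ (3 * b + 2) : Set (Site 2)) | (z 0 ≤ (b : ℤ) ∨ (M₂ : ℤ) ≤ z 0 + b) → 2 * (b : ℤ) + 2 ≤ z 1} (leftSide M₂ (3 * b + 2) : Set (Site 2)) (rightSide M₂ (3 * b + 2) : Set (Site 2)) ∩ (BondConfig.relabel (sym2Equiv (Site.shift (-pt 0 (2 * (b : ℤ) + 2))))) ⁻¹' tbCrossing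 b b) ∩ (dualConfig ⁻¹' openCrossing {z ∈ ((· + pt (-1) 0) '' (rectangle (M₂ + 1) (3 * b + 1) : Set (Site 2))) | (z 0 ≤ (b : ℤ) ∨ (M₂ : ℤ) ≤ z 0 + b) → (b : ℤ) + 1 ≤ z 1 ∧ z 1 ≤ 2 * (b : ℤ)} ((· + pt (-1) 0) '' (leftSide (M₂ + 1) (3 * b + 1) : Set (Site 2))) ((· + pt (-1) 0) '' (rightSide (M₂ + 1) (3 * b + 1) : Set (Site 2))))) ∩ (lrCrossingAt (pt ((M₁ : ℤ) - b) 0) (3 * b + 2) b ∩ (BondConfig.relabel (sym2Equiv (Site.shift (-pt ((M₁ : ℤ) - b) 0)))) ⁻¹' tbCrossing b b ∩ (BondConfig.relabel (sym2Equiv (Site.shift (-pt ((M₁ : ℤ) + b + 2) 0)))) ⁻¹' tbCrossing b b ∩ lrCrossingAt (pt ((M₁ : ℤ) - b) (2 * (b : ℤ) + 2)) (3 * b + 2) b ∩ (BondConfig.relabel (sym2Equiv (Site.shift (-pt ((M₁ : ℤ) - b) (2 * (b : ℤ) + 2))))) ⁻¹' tbCrossing b b ∩ (BondConfig.relabel (sym2Equiv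 (Site.shift (-pt ((M₁ : ℤ) + b + 2) (2 * (b : ℤ) + 2))))) ⁻¹' tbCrossing b b) ∩ (dualConfig ⁻¹' (lrCrossingAt (pt ((M₁ : ℤ) - b) ((b : ℤ) + 1)) (3 * b + 2) (b - 1) ∩ (BondConfig.relabel (sym2Equiv (Site.shift (-pt ((M₁ : ℤ) - b) ((b : ℤ) + 1))))) ⁻¹' tbCrossing b (b - 1) ∩ (BondConfig.relabel (sym2Equiv (Site.shift (-pt ((M₁ : ℤ) + b + 1) ((b : ℤ) + 1))))) ⁻¹' tbCrossing (b + 1) (b - 1)))) ≤ (bondPercolation (zdGraph 2) half).real ((openCrossing {z ∈ (rectangle (M₁ + b + 2 + M₂ : ℕ) (3 * b + 2) : Set (Site 2)) | (z 0 ≤ (b : ℤ) ∨ ((M₁ + b + 2 + M₂ : ℕ) : ℤ) ≤ z 0 + b) → z 1 ≤ (b : ℤ)} (leftSide (M₁ + b + 2 + M₂ : ℕ) (3 * b + 2) : Set (Site 2)) (rightSide (M₁ + b + 2 + M₂ : ℕ) (3 * b + 2) : Set (Site 2)) ∩ tbCrossing b b ∩ openCrossing {z ∈ (rectangle (M₁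 + b + 2 + M₂ : ℕ) (3 * b + 2) : Set (Site 2)) | (z 0 ≤ (b : ℤ) ∨ ((M₁ + b + 2 + M₂ : ℕ) : ℤ) ≤ z 0 + b) → 2 * (b : ℤ) + 2 ≤ z 1} (leftSide (M₁ + b + 2 + M₂ : ℕ) (3 * b + 2) : Set (Site 2)) (rightSide (M₁ + b + 2 + M₂ : ℕ) (3 * b + 2) : Set (Site 2)) ∩ (BondConfig.relabel (sym2Equiv (Site.shift (-pt 0 (2 * (b : ℤ) + 2))))) ⁻¹' tbCrossing b b) ∩ (dualConfig ⁻¹' openCrossing {z ∈ ((· + pt (-1) 0) '' (rectangle ((M₁ + b + 2 + M₂ : ℕ) + 1) (3 * b + 1) : Set (Site 2))) | (z 0 ≤ (b : ℤ) ∨ ((M₁ + b + 2 + M₂ : ℕ) : ℤ) ≤ z 0 + b) → (b : ℤ) + 1 ≤ z 1 ∧ z 1 ≤ 2 * (b : ℤ)} ((· + pt (-1) 0) '' (leftSide ((M₁ + b + 2 + M₂ : ℕ) + 1) (3 * b + 1) : Set (Site 2))) ((· + pt (-1) 0) '' (rightSide ((M₁ + b + 2 + M₂ : ℕ) + 1)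 (3 * b + 1) : Set (Site 2))))) := by
    refine ENNReal.toReal_mono (measure_ne_top _ _) (measure_mono_ae ?_)
    filter_upwards [ae_subset_edgeSet (zdGraph 2) half] with ω hω h
    obtain ⟨⟨⟨h₁, h₂⟩, hgp⟩, hgm⟩ := h
    exact ⟨stub_cgGluePlus M₁ M₂ b hb1 hM₁ hM₂ ω hω h₁.1 h₂.1 hgp,
      stub_cgGlueMinus M₁ M₂ b hb1 hM₁ hM₂ ω hω h₁.2 h₂.2 hgm⟩
  have hf₁ : 0 ≤ (bondPercolation (zdGraph 2) half).real ((openCrossing {z ∈ (rectangle M₁ (3 * b + 2) : Set (Site 2)) | (z 0 ≤ (b : ℤ) ∨ (M₁ : ℤ) ≤ z 0 + b) → z 1 ≤ (b : ℤ)} (leftSide M₁ (3 * b + 2) : Set (Site 2)) (rightSide M₁ (3 * b + 2) : Set (Site 2)) ∩ tbCrossing b b ∩ openCrossing {z ∈ (rectangle M₁ (3 * b + 2) : Set (Site 2)) | (z 0 ≤ (b : ℤ) ∨ (M₁ : ℤ) ≤ z 0 + b) → 2 * (b : ℤ) + 2 ≤ z 1} (leftSide M₁ (3 * b + 2) : Set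 (Site 2)) (rightSide M₁ (3 * b + 2) : Set (Site 2)) ∩ (BondConfig.relabel (sym2Equiv (Site.shift (-pt 0 (2 * (b : ℤ) + 2))))) ⁻¹' tbCrossing b b) ∩ (dualConfig ⁻¹' openCrossing {z ∈ ((· + pt (-1) 0) '' (rectangle (M₁ + 1) (3 * b + 1) : Set (Site 2))) | (z 0 ≤ (b : ℤ) ∨ (M₁ : ℤ) ≤ z 0 + b) → (b : ℤ) + 1 ≤ z 1 ∧ z 1 ≤ 2 * (b : ℤ)} ((· + pt (-1) 0) '' (leftSide (M₁ + 1) (3 * b + 1) : Set (Site 2))) ((· + pt (-1) 0) '' (rightSide (M₁ + 1) (3 * b + 1) : Set (Site 2))))) := measureReal_nonneg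
  have hf₂ : 0 ≤ (bondPercolation (zdGraph 2) half).real ((openCrossing {z ∈ (rectangle M₂ (3 * b + 2) : Set (Site 2)) | (z 0 ≤ (b : ℤ) ∨ (M₂ : ℤ) ≤ z 0 + b) → z 1 ≤ (b : ℤ)} (leftSide M₂ (3 * b + 2) : Set (Site 2)) (rightSide M₂ (3 * b + 2) : Set (Site 2)) ∩ tbCrossing b b ∩ openCrossing {z ∈ (rectangle M₂ (3 * b + 2) : Set (Site 2)) | (z 0 ≤ (b : ℤ) ∨ (M₂ : ℤ) ≤ z 0 + b) → 2 * (b : ℤ) + 2 ≤ z 1} (leftSide M₂ (3 * b + 2) : Set (Site 2)) (rightSide M₂ (3 * b + 2) : Set (Site 2)) ∩ (BondConfig.relabel (sym2Equiv (Site.shift (-pt 0 (2 * (b : ℤ) + 2))))) ⁻¹' tbCrossing b b) ∩ (dualConfig ⁻¹' openCrossing {z ∈ ((· + pt (-1) 0) '' (rectangle (M₂ + 1) (3 * b + 1) : Set (Site 2))) | (z 0 ≤ (b : ℤ) ∨ (M₂ : ℤ) ≤ z 0 + b) → (b : ℤ) + 1 ≤ z 1 ∧ z 1 ≤ 2 *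 (b : ℤ)} ((· + pt (-1) 0) '' (leftSide (M₂ + 1) (3 * b + 1) : Set (Site 2))) ((· + pt (-1) 0) '' (rightSide (M₂ + 1) (3 * b + 1) : Set (Site 2))))) := measureReal_nonneg
  calc min c 1 * (bondPercolation (zdGraph 2) half).real ((openCrossing {z ∈ (rectangle M₁ (3 * b + 2) : Set (Site 2)) | (z 0 ≤ (b : ℤ) ∨ (M₁ : ℤ) ≤ z 0 + b) → z 1 ≤ (b : ℤ)} (leftSide M₁ (3 * b + 2) : Set (Site 2)) (rightSide M₁ (3 * b + 2) : Set (Site 2)) ∩ tbCrossing b b ∩ openCrossing {z ∈ (rectangle M₁ (3 * b + 2) : Set (Site 2)) | (z 0 ≤ (b : ℤ) ∨ (M₁ : ℤ) ≤ z 0 + b) → 2 * (b : ℤ) + 2 ≤ z 1} (leftSide M₁ (3 * b + 2) : Set (Site 2)) (rightSide M₁ (3 * b + 2) : Set (Site 2)) ∩ (BondConfig.relabel (sym2Equiv (Site.shift (-pt 0 (2 * (b : ℤ) + 2))))) ⁻¹' tbCrossing b b) ∩ (dualConfig ⁻¹' openCrossing {z ∈ ((· + pt (-1) 0) '' (rectangle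 (M₁ + 1) (3 * b + 1) : Set (Site 2))) | (z 0 ≤ (b : ℤ) ∨ (M₁ : ℤ) ≤ z 0 + b) → (b : ℤ) + 1 ≤ z 1 ∧ z 1 ≤ 2 * (b : ℤ)} ((· + pt (-1) 0) '' (leftSide (M₁ + 1) (3 * b + 1) : Set (Site 2))) ((· + pt (-1) 0) '' (rightSide (M₁ + 1) (3 * b + 1) : Set (Site 2))))) * (bondPercolation (zdGraph 2) half).real ((openCrossing {z ∈ (rectangle M₂ (3 * b + 2) : Set (Site 2)) | (z 0 ≤ (b : ℤ) ∨ (M₂ : ℤ) ≤ z 0 + b) → z 1 ≤ (b : ℤ)} (leftSide M₂ (3 * b + 2) : Set (Site 2)) (rightSide M₂ (3 * b + 2) : Set (Site 2)) ∩ tbCrossing b b ∩ openCrossing {z ∈ (rectangle M₂ (3 * b + 2) : Set (Site 2)) | (z 0 ≤ (b : ℤ) ∨ (M₂ : ℤ) ≤ z 0 + b) → 2 * (b : ℤ) + 2 ≤ z 1} (leftSide M₂ (3 * b + 2) : Set (Site 2)) (rightSide M₂ (3 * b + 2) : Set (Site 2)) ∩ (BondConfig.relabel (sym2Equiv (Site.shift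 (-pt 0 (2 * (b : ℤ) + 2))))) ⁻¹' tbCrossing b b) ∩ (dualConfig ⁻¹' openCrossing {z ∈ ((· + pt (-1) 0) '' (rectangle (M₂ + 1) (3 * b + 1) : Set (Site 2))) | (z 0 ≤ (b : ℤ) ∨ (M₂ : ℤ) ≤ z 0 + b) → (b : ℤ) + 1 ≤ z 1 ∧ z 1 ≤ 2 * (b : ℤ)} ((· + pt (-1) 0) '' (leftSide (M₂ + 1) (3 * b + 1) : Set (Site 2))) ((· + pt (-1) 0) '' (rightSide (M₂ + 1) (3 * b + 1) : Set (Site 2)))))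
      ≤ c * (bondPercolation (zdGraph 2) half).real ((openCrossing {z ∈ (rectangle M₁ (3 * b + 2) : Set (Site 2)) | (z 0 ≤ (b : ℤ) ∨ (M₁ : ℤ) ≤ z 0 + b) → z 1 ≤ (b : ℤ)} (leftSide M₁ (3 * b + 2) : Set (Site 2)) (rightSide M₁ (3 * b + 2) : Set (Site 2)) ∩ tbCrossing b b ∩ openCrossing {z ∈ (rectangle M₁ (3 * b + 2) : Set (Site 2)) | (z 0 ≤ (b : ℤ) ∨ (M₁ : ℤ) ≤ z 0 + b) → 2 * (b : ℤ) + 2 ≤ z 1} (leftSide M₁ (3 * b + 2) : Set (Site 2)) (rightSide M₁ (3 * b + 2) : Set (Site 2)) ∩ (BondConfig.relabel (sym2Equiv (Site.shift (-pt 0 (2 * (b : ℤ) + 2))))) ⁻¹' tbCrossing b b) ∩ (dualConfig ⁻¹' openCrossing {z ∈ ((· + pt (-1) 0) '' (rectangle (M₁ + 1) (3 * b + 1) : Set (Site 2))) | (z 0 ≤ (b : ℤ) ∨ (M₁ : ℤ) ≤ z 0 + b) → (b : ℤ) + 1 ≤ z 1 ∧ z 1 ≤ 2 * (b : ℤ)}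 ((· + pt (-1) 0) '' (leftSide (M₁ + 1) (3 * b + 1) : Set (Site 2))) ((· + pt (-1) 0) '' (rightSide (M₁ + 1) (3 * b + 1) : Set (Site 2))))) * (bondPercolation (zdGraph 2) half).real ((openCrossing {z ∈ (rectangle M₂ (3 * b + 2) : Set (Site 2)) | (z 0 ≤ (b : ℤ) ∨ (M₂ : ℤ) ≤ z 0 + b) → z 1 ≤ (b : ℤ)} (leftSide M₂ (3 * b + 2) : Set (Site 2)) (rightSide M₂ (3 * b + 2) : Set (Site 2)) ∩ tbCrossing b b ∩ openCrossing {z ∈ (rectangle M₂ (3 * b + 2) : Set (Site 2)) | (z 0 ≤ (b : ℤ) ∨ (M₂ : ℤ) ≤ z 0 + b) → 2 * (b : ℤ) + 2 ≤ z 1} (leftSide M₂ (3 * b + 2) : Set (Site 2)) (rightSide M₂ (3 * b + 2) : Set (Site 2)) ∩ (BondConfig.relabel (sym2Equiv (Site.shift (-pt 0 (2 * (b : ℤ) + 2))))) ⁻¹' tbCrossing b b) ∩ (dualConfig ⁻¹' openCrossing {z ∈ ((· + pt (-1) 0) '' (rectangle (M₂ + 1) (3 * b + 1) : Set (Site 2)))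 | (z 0 ≤ (b : ℤ) ∨ (M₂ : ℤ) ≤ z 0 + b) → (b : ℤ) + 1 ≤ z 1 ∧ z 1 ≤ 2 * (b : ℤ)} ((· + pt (-1) 0) '' (leftSide (M₂ + 1) (3 * b + 1) : Set (Site 2))) ((· + pt (-1) 0) '' (rightSide (M₂ + 1) (3 * b + 1) : Set (Site 2))))) :=
        mul_le_mul_of_nonneg_right (mul_le_mul_of_nonneg_right (min_le_left c 1) hf₁) hf₂
    _ = c * (bondPercolation (zdGraph 2) half).real (((openCrossing {z ∈ (rectangle M₁ (3 * b + 2) : Set (Site 2)) | (z 0 ≤ (b : ℤ) ∨ (M₁ : ℤ) ≤ z 0 + b) → z 1 ≤ (b : ℤ)} (leftSide M₁ (3 * b + 2) : Set (Site 2)) (rightSide M₁ (3 * b + 2) : Set (Site 2)) ∩ tbCrossing b b ∩ openCrossing {z ∈ (rectangle M₁ (3 * b + 2) : Set (Site 2)) | (z 0 ≤ (b : ℤ) ∨ (M₁ : ℤ) ≤ z 0 + b) → 2 * (b : ℤ) + 2 ≤ z 1} (leftSide M₁ (3 * b + 2) : Set (Site 2)) (rightSide M₁ (3 * b + 2) :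 Set (Site 2)) ∩ (BondConfig.relabel (sym2Equiv (Site.shift (-pt 0 (2 * (b : ℤ) + 2))))) ⁻¹' tbCrossing b b) ∩ (dualConfig ⁻¹' openCrossing {z ∈ ((· + pt (-1) 0) '' (rectangle (M₁ + 1) (3 * b + 1) : Set (Site 2))) | (z 0 ≤ (b : ℤ) ∨ (M₁ : ℤ) ≤ z 0 + b) → (b : ℤ) + 1 ≤ z 1 ∧ z 1 ≤ 2 * (b : ℤ)} ((· + pt (-1) 0) '' (leftSide (M₁ + 1) (3 * b + 1) : Set (Site 2))) ((· + pt (-1) 0) '' (rightSide (M₁ + 1) (3 * b + 1) : Set (Site 2))))) ∩ (BondConfig.relabel (sym2Equiv (Site.shift (-pt ((M₁ : ℤ) + b + 2) 0)))) ⁻¹' ((openCrossing {z ∈ (rectangle M₂ (3 * b + 2) : Set (Site 2)) | (z 0 ≤ (b : ℤ) ∨ (M₂ : ℤ) ≤ z 0 + b) → z 1 ≤ (b : ℤ)} (leftSide M₂ (3 * b + 2) : Set (Site 2)) (rightSide M₂ (3 * b + 2) : Set (Site 2)) ∩ tbCrossing b b ∩ openCrossing {z ∈ (rectangle M₂ (3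 * b + 2) : Set (Site 2)) | (z 0 ≤ (b : ℤ) ∨ (M₂ : ℤ) ≤ z 0 + b) → 2 * (b : ℤ) + 2 ≤ z 1} (leftSide M₂ (3 * b + 2) : Set (Site 2)) (rightSide M₂ (3 * b + 2) : Set (Site 2)) ∩ (BondConfig.relabel (sym2Equiv (Site.shift (-pt 0 (2 * (b : ℤ) + 2))))) ⁻¹' tbCrossing b b) ∩ (dualConfig ⁻¹' openCrossing {z ∈ ((· + pt (-1) 0) '' (rectangle (M₂ + 1) (3 * b + 1) : Set (Site 2))) | (z 0 ≤ (b : ℤ) ∨ (M₂ : ℤ) ≤ z 0 + b) → (b : ℤ) + 1 ≤ z 1 ∧ z 1 ≤ 2 * (b : ℤ)} ((· + pt (-1) 0) '' (leftSide (M₂ + 1) (3 * b + 1) : Set (Site 2))) ((· + pt (-1) 0) '' (rightSide (M₂ + 1) (3 * b + 1) : Set (Site 2)))))) := by rw [mul_assoc, hind]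
    _ ≤ _ := hl
    _ ≤ _ := hsub

/-- **`f ≤ p₂`**: the end-confined structure has two spanning clusters (`1 ≤ b`, `b+1 ≤ M`). [folklore] -/
theorem cg_f_le_pTwo (f : ℕ → ℕ → ℝ)
    (hf : f = (fun M b : ℕ => (bondPercolation (zdGraph 2) half).real ((openCrossing {z ∈ (rectangle M (3 * b + 2) : Set (Site 2)) | (z 0 ≤ (b : ℤ) ∨ (M : ℤ) ≤ z 0 + b) → z 1 ≤ (b : ℤ)} (leftSide M (3 * b + 2) : Set (Site 2)) (rightSide M (3 * b + 2) : Set (Site 2)) ∩ tbCrossing b b ∩ openCrossing {z ∈ (rectangle M (3 * b + 2) : Set (Site 2)) | (z 0 ≤ (b : ℤ) ∨ (M : ℤ) ≤ z 0 + b) → 2 * (b : ℤ) + 2 ≤ z 1} (leftSide M (3 * b + 2) : Set (Site 2)) (rightSide M (3 * b + 2) : Set (Site 2)) ∩ (BondConfig.relabel (sym2Equiv (Site.shift (-pt 0 (2 * (b : ℤ) + 2))))) ⁻¹' tbCrossing b b) ∩ (dualConfig ⁻¹' openCrossing {z ∈ ((· + pt (-1) 0) '' (rectangle (M + 1) (3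 * b + 1) : Set (Site 2))) | (z 0 ≤ (b : ℤ) ∨ (M : ℤ) ≤ z 0 + b) → (b : ℤ) + 1 ≤ z 1 ∧ z 1 ≤ 2 * (b : ℤ)} ((· + pt (-1) 0) '' (leftSide (M + 1) (3 * b + 1) : Set (Site 2))) ((· + pt (-1) 0) '' (rightSide (M + 1) (3 * b + 1) : Set (Site 2)))))))
    {M b : ℕ} (hb : 1 ≤ b) (hM : b + 1 ≤ M) : f M b ≤ pTwo M (3 * b + 2) := by
  subst hf
  refine ENNReal.toReal_mono (measure_ne_top _ _) (measure_mono_ae ?_)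
  filter_upwards [ae_subset_edgeSet (zdGraph 2) half] with ω hω h
  exact stub_cgTwoCluster M b hb hM ω hω h.1 h.2

/-! ## §2 The finite-length upper bound on `γ₂` from confined gluing -/

/-- **`γ₂(3b+2) ≤ (−log f(M,b) − log c)/(M + b + 2)`** for `b ≥ 3`, `M ≥ b+1` with `f(M,b) > 0`, for every limit `γ` of
`−log p₂(m, 3b+2)/m`. [folklore] -/
theorem cg_rateTwo_le_confined : ∃ c : ℝ, 0 < c ∧ c ≤ 1 ∧ ∀ f : ℕ → ℕ → ℝ,
    f = (fun M b : ℕ => (bondPercolation (zdGraph 2) half).real ((openCrossing {z ∈ (rectangle M (3 * b + 2) : Set (Site 2)) | (z 0 ≤ (b : ℤ) ∨ (M : ℤ) ≤ z 0 + b) → z 1 ≤ (b : ℤ)} (leftSide M (3 * b + 2) : Set (Site 2)) (rightSide M (3 * b + 2) : Set (Site 2)) ∩ tbCrossing b b ∩ openCrossing {z ∈ (rectangle M (3 * b + 2) : Set (Site 2)) | (z 0 ≤ (b : ℤ) ∨ (M : ℤ) ≤ z 0 + b) → 2 * (b : ℤ) + 2 ≤ z 1} (leftSide M (3 * b + 2)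 : Set (Site 2)) (rightSide M (3 * b + 2) : Set (Site 2)) ∩ (BondConfig.relabel (sym2Equiv (Site.shift (-pt 0 (2 * (b : ℤ) + 2))))) ⁻¹' tbCrossing b b) ∩ (dualConfig ⁻¹' openCrossing {z ∈ ((· + pt (-1) 0) '' (rectangle (M + 1) (3 * b + 1) : Set (Site 2))) | (z 0 ≤ (b : ℤ) ∨ (M : ℤ) ≤ z 0 + b) → (b : ℤ) + 1 ≤ z 1 ∧ z 1 ≤ 2 * (b : ℤ)} ((· + pt (-1) 0) '' (leftSide (M + 1) (3 * b + 1) : Set (Site 2))) ((· + pt (-1) 0) '' (rightSide (M + 1) (3 * b + 1) : Set (Site 2)))))) →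
    ∀ (b M : ℕ), 3 ≤ b → b + 1 ≤ M → ∀ γ : ℝ, Tendsto (rateSeqTwo (3 * b + 2)) atTop (𝓝 γ) → 0 < f M b →
      γ ≤ (-Real.log (f M b) - Real.log c) / ((M : ℝ) + (b + 2 : ℕ)) := by
  obtain ⟨c, hc, hc1, hsup⟩ := cg_f_supermul
  refine ⟨c, hc, hc1, fun f hf b M hb hM γ hγ hfM => ?_⟩
  have hb1 : 1 ≤ b := le_trans (by norm_num) hb
  have hN : 1 ≤ 3 * b + 2 := by omega
  have hf0 : ∀ m, 0 ≤ f m b := by intro m; rw [hf]; exact measureReal_nonneg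
  have key := cg_rate_le_of_supermul (fun m ↦ pTwo m (3 * b + 2)) (fun m ↦ f m b) c γ (b + 2) (b + 1) hc (by omega)
    (fun m ↦ co_pTwo_pos hN m) (fun m hm ↦ cg_f_le_pTwo f hf hb1 hm) hf0
    (fun M₁ M₂ h₁ h₂ ↦ by
      simpa only [show M₁ + (b + 2) + M₂ = M₁ + b + 2 + M₂ by omega] using hsup f hf M₁ M₂ b hb h₁ h₂)
    hγ M hM hfM
  simpa using key

/-! ## §3 The order transfer: `n·γ₂(n) → 2π` from Cardy-order two-cluster Kac -/

/-- `(u + κ)/A → 2π` along `A → ∞` whenever `u(A)/A → 2π`. [folklore] -/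
theorem cg_tendsto_add_const_div {u : ℕ → ℝ} (hu : Tendsto (fun A : ℕ ↦ u A / A) atTop (𝓝 (2 * Real.pi))) (κ : ℝ) :
    Tendsto (fun A : ℕ ↦ (u A + κ) / A) atTop (𝓝 (2 * Real.pi)) := by
  have h1 : Tendsto (fun A : ℕ ↦ κ / (A : ℝ)) atTop (𝓝 0) := tendsto_const_nhds.div_atTop tendsto_natCast_atTop_atTop
  have := hu.add h1
  rw [add_zero] at this
  refine this.congr' ?_
  filter_upwards [eventually_ge_atTop 1] with A hA
  rw [add_div]

/-- **The order transfer by confined gluing** (registered helper `tendsto_nMul_rateTwo_of_cardyOrderTwo` of crux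
`StripClusterRates`): Cardy-order two-cluster Kac in the two-sided form CO₂ — `p₂(A·n, n) ≤ e^{−g(A)}` eventually in `n`
with `g(A)/A → 2π`, and `f(A(3b+2), b) ≥ e^{−G(A)}` eventually in `b` with `G(A)/A → 2π` — implies `n·γ₂(n) → 2π` for EVERY
family `γ₂` of two-cluster rates (the γ₂-conjunct of the crux). [cite: Cardy1998, eq. (bb)] -/
theorem tendsto_nMul_rateTwo_of_cardyOrderTwo :
    (∃ g : ℕ → ℝ, Tendsto (fun A : ℕ ↦ g A / A) atTop (𝓝 (2 * Real.pi)) ∧ ∀ A : ℕ, 1 ≤ A → ∀ᶠ n : ℕ in atTop, (bondPercolation (zdGraph 2) half).real {ω | ∃ x₁ ∈ (leftSide (A * n) n : Set (Site 2)), ∃ y₁ ∈ (rightSide (A * n) n : Set (Site 2)), ∃ x₂ ∈ (leftSide (A * n) n : Set (Site 2)), ∃ y₂ ∈ (rightSide (A * n) n : Set (Site 2)), ω ∈ openConnIn (rectangle (A * n) n : Set (Site 2)) x₁ y₁ ∧ ω ∈ openConnIn (rectangle (A * n) n : Set (Site 2)) x₂ y₂ ∧ ω ∉ openConnIn (rectangle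 (A * n) n : Set (Site 2)) x₁ x₂} ≤ Real.exp (-g A)) ∧ (∃ G : ℕ → ℝ, Tendsto (fun A : ℕ ↦ G A / A) atTop (𝓝 (2 * Real.pi)) ∧ ∀ A : ℕ, 1 ≤ A → ∀ᶠ b : ℕ in atTop, Real.exp (-G A) ≤ (bondPercolation (zdGraph 2) half).real ((openCrossing {z ∈ (rectangle (A * (3 * b + 2) : ℕ) (3 * b + 2) : Set (Site 2)) | (z 0 ≤ (b : ℤ) ∨ ((A * (3 * b + 2) : ℕ) : ℤ) ≤ z 0 + b) → z 1 ≤ (b : ℤ)} (leftSide (A * (3 * b + 2) : ℕ) (3 * b + 2) : Set (Site 2)) (rightSide (A * (3 * b + 2) : ℕ) (3 * b + 2) : Set (Site 2)) ∩ tbCrossing b b ∩ openCrossing {z ∈ (rectangle (A * (3 * b + 2) : ℕ) (3 * b + 2) : Set (Site 2)) | (z 0 ≤ (b : ℤ) ∨ ((A * (3 * b + 2) : ℕ) : ℤ) ≤ z 0 + b) → 2 * (b : ℤ) + 2 ≤ z 1} (leftSide (A * (3 * b + 2) : ℕ) (3 * b + 2) : Set (Site 2)) (rightSide (A * (3 *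 b + 2) : ℕ) (3 * b + 2) : Set (Site 2)) ∩ (BondConfig.relabel (sym2Equiv (Site.shift (-pt 0 (2 * (b : ℤ) + 2))))) ⁻¹' tbCrossing b b) ∩ (dualConfig ⁻¹' openCrossing {z ∈ ((· + pt (-1) 0) '' (rectangle ((A * (3 * b + 2) : ℕ) + 1) (3 * b + 1) : Set (Site 2))) | (z 0 ≤ (b : ℤ) ∨ ((A * (3 * b + 2) : ℕ) : ℤ) ≤ z 0 + b) → (b : ℤ) + 1 ≤ z 1 ∧ z 1 ≤ 2 * (b : ℤ)} ((· + pt (-1) 0) '' (leftSide ((A * (3 * b + 2) : ℕ) + 1) (3 * b + 1) : Set (Site 2))) ((· + pt (-1) 0) '' (rightSide ((A * (3 * b + 2) : ℕ) + 1) (3 * b + 1) : Set (Site 2)))))) → ∀ γ₂ : ℕ → ℝ, (∀ n : ℕ, 1 ≤ n → Tendsto (fun m : ℕ ↦ -Real.log ((bondPercolation (zdGraph 2) half).real {ω | ∃ x₁ ∈ (leftSide m n : Set (Site 2)), ∃ y₁ ∈ (rightSide m n : Set (Site 2)), ∃ x₂ ∈ (leftSide m n : Set (Site 2)), ∃ y₂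 ∈ (rightSide m n : Set (Site 2)), ω ∈ openConnIn (rectangle m n : Set (Site 2)) x₁ y₁ ∧ ω ∈ openConnIn (rectangle m n : Set (Site 2)) x₂ y₂ ∧ ω ∉ openConnIn (rectangle m n : Set (Site 2)) x₁ x₂}) / (m : ℝ)) atTop (𝓝 (γ₂ n))) → Tendsto (fun n : ℕ ↦ (n : ℝ) * γ₂ n) atTop (𝓝 (2 * Real.pi)) := by
  intro hCO γ₂ h₂
  obtain ⟨⟨g, hg, hup⟩, ⟨G, hG, hlow⟩⟩ := hCO
  obtain ⟨f, hf⟩ : ∃ f : ℕ → ℕ → ℝ, f = (fun M b : ℕ => (bondPercolation (zdGraph 2) half).real ((openCrossing {z ∈ (rectangle M (3 * b + 2) : Set (Site 2)) | (z 0 ≤ (b : ℤ) ∨ (M : ℤ) ≤ z 0 + b) → z 1 ≤ (b : ℤ)} (leftSide M (3 * b + 2) : Set (Site 2)) (rightSide M (3 * b + 2) : Set (Site 2)) ∩ tbCrossing b b ∩ openCrossing {z ∈ (rectangle M (3 * b + 2) : Set (Site 2)) | (z 0 ≤ (b : ℤ) ∨ (M : ℤ) ≤ z 0 + b) → 2 *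 (b : ℤ) + 2 ≤ z 1} (leftSide M (3 * b + 2) : Set (Site 2)) (rightSide M (3 * b + 2) : Set (Site 2)) ∩ (BondConfig.relabel (sym2Equiv (Site.shift (-pt 0 (2 * (b : ℤ) + 2))))) ⁻¹' tbCrossing b b) ∩ (dualConfig ⁻¹' openCrossing {z ∈ ((· + pt (-1) 0) '' (rectangle (M + 1) (3 * b + 1) : Set (Site 2))) | (z 0 ≤ (b : ℤ) ∨ (M : ℤ) ≤ z 0 + b) → (b : ℤ) + 1 ≤ z 1 ∧ z 1 ≤ 2 * (b : ℤ)} ((· + pt (-1) 0) '' (leftSide (M + 1) (3 * b + 1) : Set (Site 2))) ((· + pt (-1) 0) '' (rightSide (M + 1) (3 * b + 1) : Set (Site 2)))))) := ⟨_, rfl⟩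
  obtain ⟨c, hc, hc1, hrate⟩ := cg_rateTwo_le_confined
  have hlowf : ∀ A : ℕ, 1 ≤ A → ∀ᶠ b : ℕ in atTop, Real.exp (-G A) ≤ f (A * (3 * b + 2)) b := by
    intro A hA; rw [hf]; exact hlow A hA
  have hf1 : ∀ M b, f M b ≤ 1 := by intro M b; rw [hf]; exact measureReal_le_one
  have hf0 : ∀ M b, 0 ≤ f M b := by intro M b; rw [hf]; exact measureReal_nonneg
  rw [tendsto_order]
  constructor
  · -- liminf half (c5's argument): sub-multiplicativity at a good aspect ratio
    intro a ha
    obtain ⟨A, hA1, hA⟩ : ∃ A : ℕ, 1 ≤ A ∧ a < g A / A := by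
      obtain ⟨A, hA⟩ := (((tendsto_order.1 hg).1 a ha).and (eventually_ge_atTop 1)).exists
      exact ⟨A, hA.2, hA.1⟩
    have hcmp : Tendsto (fun n : ℕ ↦ g A * ((n : ℝ) / ((A : ℝ) * n + 1))) atTop (𝓝 (g A * (1 / (A : ℝ)))) :=
      tendsto_const_nhds.mul (co_tendsto_div_aspect hA1)
    rw [mul_one_div] at hcmp
    have hev := (tendsto_order.1 hcmp).1 a hA
    filter_upwards [hev, eventually_ge_atTop 1, hup A hA1] with n hn hn1 hupn
    refine lt_of_lt_of_le hn ?_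
    have h := nMul_rateTwo_ge_finite hn1 (h₂ n hn1) (A * n)
    have hden : ((A * n : ℕ) : ℝ) + 1 = (A : ℝ) * n + 1 := by push_cast; ring
    rw [hden] at h
    have hpos : 0 < pTwo (A * n) n := co_pTwo_pos hn1 _
    have hlog : g A ≤ -Real.log (pTwo (A * n) n) := by
      have := Real.log_le_log hpos hupn
      rw [Real.log_exp] at this
      linarith
    have hn0 : (0 : ℝ) ≤ (n : ℝ) / ((A : ℝ) * n + 1) := by positivity
    calc g A * ((n : ℝ) / ((A : ℝ) * n + 1)) ≤ -Real.log (pTwo (A * n) n) * ((n : ℝ) / ((A : ℝ) * n + 1)) :=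
          mul_le_mul_of_nonneg_right hlog hn0
      _ = (n : ℝ) * (-Real.log (pTwo (A * n) n) / ((A : ℝ) * n + 1)) := by ring
      _ ≤ (n : ℝ) * γ₂ n := h
  · -- limsup half (reshape 5): confined gluing at a good aspect ratio, widths `3β+2 ≤ n ≤ 3β+4`
    intro a ha
    have hratio := cg_tendsto_add_const_div hG (-Real.log c)
    obtain ⟨a', ha', haa'⟩ : ∃ a', 2 * Real.pi < a' ∧ a' < a := exists_between ha
    obtain ⟨A, hA1, hA⟩ : ∃ A : ℕ, 1 ≤ A ∧ (G A + -Real.log c) / A < a' := by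
      obtain ⟨A, hA⟩ := (((tendsto_order.1 hratio).2 a' ha').and (eventually_ge_atTop 1)).exists
      exact ⟨A, hA.2, hA.1⟩
    have hA0 : (0 : ℝ) < A := by exact_mod_cast hA1
    have hlc : 0 ≤ -Real.log c := by rw [neg_nonneg]; exact Real.log_nonpos hc.le hc1
    have hβ : Tendsto (fun n : ℕ ↦ (n - 2) / 3) atTop atTop := by
      refine tendsto_atTop_atTop.2 fun B ↦ ⟨3 * B + 2, fun n hn ↦ ?_⟩
      omega
    have hlow' := hβ.eventually ((hlowf A hA1).and (eventually_ge_atTop 3))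
    have hfac : Tendsto (fun n : ℕ ↦ (G A + -Real.log c) / A * (1 + 2 / (3 * (((n - 2) / 3 : ℕ) : ℝ) + 2))) atTop
        (𝓝 ((G A + -Real.log c) / A * (1 + 0))) := by
      refine tendsto_const_nhds.mul (tendsto_const_nhds.add ?_)
      refine tendsto_const_nhds.div_atTop ?_
      refine tendsto_atTop_add_const_right _ _ (Tendsto.const_mul_atTop (by norm_num) ?_)
      exact tendsto_natCast_atTop_atTop.comp hβ
    rw [add_zero, mul_one] at hfac
    have hev := (tendsto_order.1 hfac).2 a (lt_trans hA haa')
    filter_upwards [hev, hlow', eventually_ge_atTop 11] with n hn hlown hn11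
    obtain ⟨hlowβ, hβ3⟩ := hlown
    set β : ℕ := (n - 2) / 3 with hβdef
    have hβn : 3 * β + 2 ≤ n := by omega
    have hnβ : n ≤ 3 * β + 4 := by omega
    have hN1 : 1 ≤ 3 * β + 2 := by omega
    have hn1 : 1 ≤ n := by omega
    have hanti : γ₂ n ≤ γ₂ (3 * β + 2) := rateTwo_antitone hN1 hβn (h₂ _ hN1) (h₂ n hn1)
    have hfpos : 0 < f (A * (3 * β + 2)) β := lt_of_lt_of_le (Real.exp_pos _) hlowβ
    have hM : β + 1 ≤ A * (3 * β + 2) := by nlinarith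
    have hbound := hrate f hf β (A * (3 * β + 2)) hβ3 hM (γ₂ (3 * β + 2)) (h₂ _ hN1) hfpos
    have hlogf : -Real.log (f (A * (3 * β + 2)) β) ≤ G A := by
      have := Real.log_le_log (Real.exp_pos _) hlowβ
      rw [Real.log_exp] at this
      linarith
    have hNpos : (0 : ℝ) < 3 * (β : ℝ) + 2 := by positivity
    have hden_ge : (A : ℝ) * (3 * (β : ℝ) + 2) ≤ ((A * (3 * β + 2) : ℕ) : ℝ) + ((β + 2 : ℕ) : ℝ) := by
      push_cast; nlinarith
    have hnum_nonneg : 0 ≤ -Real.log (f (A * (3 * β + 2)) β) - Real.log c := by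
      have h1 : 0 ≤ -Real.log (f (A * (3 * β + 2)) β) := by
        rw [neg_nonneg]; exact Real.log_nonpos (hf0 _ _) (hf1 _ _)
      linarith
    have hγN : γ₂ (3 * β + 2) ≤ (G A + -Real.log c) / A / (3 * (β : ℝ) + 2) := by
      calc γ₂ (3 * β + 2) ≤ (-Real.log (f (A * (3 * β + 2)) β) - Real.log c) /
              (((A * (3 * β + 2) : ℕ) : ℝ) + ((β + 2 : ℕ) : ℝ)) := hbound
        _ ≤ (-Real.log (f (A * (3 * β + 2)) β) - Real.log c) / ((A : ℝ) * (3 * (β : ℝ) + 2)) :=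
              div_le_div_of_nonneg_left hnum_nonneg (by positivity) hden_ge
        _ ≤ (G A + -Real.log c) / ((A : ℝ) * (3 * (β : ℝ) + 2)) := by
              refine div_le_div_of_nonneg_right ?_ (by positivity); linarith
        _ = (G A + -Real.log c) / A / (3 * (β : ℝ) + 2) := by rw [div_div]
    have hKnonneg : 0 ≤ (G A + -Real.log c) / A := by
      have hGA : 0 ≤ G A := le_trans (by rw [neg_nonneg]; exact Real.log_nonpos (hf0 _ _) (hf1 _ _)) hlogf
      positivity
    have hn0 : (0 : ℝ) ≤ n := by positivity
    have hnle : (n : ℝ) ≤ 3 * (β : ℝ) + 4 := by exact_mod_cast hnβ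
    calc (n : ℝ) * γ₂ n ≤ (n : ℝ) * ((G A + -Real.log c) / A / (3 * (β : ℝ) + 2)) :=
          mul_le_mul_of_nonneg_left (hanti.trans hγN) hn0
      _ ≤ (3 * (β : ℝ) + 4) * ((G A + -Real.log c) / A / (3 * (β : ℝ) + 2)) :=
          mul_le_mul_of_nonneg_right hnle (by positivity)
      _ = (G A + -Real.log c) / A * (1 + 2 / (3 * (β : ℝ) + 2)) := by
          field_simp
          ring
      _ < a := hn

/-- **K₂ from CO₂**: the Kac asymptotics of the relaxation rate of the unmarked planar row chain (`stub_kacTwo` of leads −1…c5,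
the transfer-matrix-order open core of the γ₂-half) FOLLOW from the Cardy-order statement CO₂, through the order transfer and
`twoClusterKac_iff_kacTwo`. [cite: Cardy1998, eq. (bb)] -/
theorem kacTwo_of_cardyOrderTwo
    (hCO : (∃ g : ℕ → ℝ, Tendsto (fun A : ℕ ↦ g A / A) atTop (𝓝 (2 * Real.pi)) ∧ ∀ A : ℕ, 1 ≤ A → ∀ᶠ n : ℕ in atTop, (bondPercolation (zdGraph 2) half).real {ω | ∃ x₁ ∈ (leftSide (A * n) n : Set (Site 2)), ∃ y₁ ∈ (rightSide (A * n) n : Set (Site 2)), ∃ x₂ ∈ (leftSide (A * n) n : Set (Site 2)), ∃ y₂ ∈ (rightSide (A * n) n : Set (Site 2)), ω ∈ openConnIn (rectangle (A * n) n : Set (Site 2)) x₁ y₁ ∧ ω ∈ openConnIn (rectangle (A * n) n : Set (Site 2)) x₂ y₂ ∧ ω ∉ openConnIn (rectangle (A * n) n : Set (Site 2)) x₁ x₂} ≤ Real.exp (-g A)) ∧ (∃ G : ℕ → ℝ, Tendsto (fun A : ℕ ↦ G A / A) atTop (𝓝 (2 * Real.pi)) ∧ ∀ A : ℕ, 1 ≤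 A → ∀ᶠ b : ℕ in atTop, Real.exp (-G A) ≤ (bondPercolation (zdGraph 2) half).real ((openCrossing {z ∈ (rectangle (A * (3 * b + 2) : ℕ) (3 * b + 2) : Set (Site 2)) | (z 0 ≤ (b : ℤ) ∨ ((A * (3 * b + 2) : ℕ) : ℤ) ≤ z 0 + b) → z 1 ≤ (b : ℤ)} (leftSide (A * (3 * b + 2) : ℕ) (3 * b + 2) : Set (Site 2)) (rightSide (A * (3 * b + 2) : ℕ) (3 * b + 2) : Set (Site 2)) ∩ tbCrossing b b ∩ openCrossing {z ∈ (rectangle (A * (3 * b + 2) : ℕ) (3 * b + 2) : Set (Site 2)) | (z 0 ≤ (b : ℤ) ∨ ((A * (3 * b + 2) : ℕ) : ℤ) ≤ z 0 + b) → 2 * (b : ℤ) + 2 ≤ z 1} (leftSide (A * (3 * b + 2) : ℕ) (3 * b + 2) : Set (Site 2)) (rightSide (A * (3 * b + 2) : ℕ) (3 * b + 2) : Set (Site 2)) ∩ (BondConfig.relabel (sym2Equiv (Site.shift (-pt 0 (2 * (b : ℤ) + 2))))) ⁻¹' tbCrossing b b) ∩ (dualConfig ⁻¹' openCrossing {z ∈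 ((· + pt (-1) 0) '' (rectangle ((A * (3 * b + 2) : ℕ) + 1) (3 * b + 1) : Set (Site 2))) | (z 0 ≤ (b : ℤ) ∨ ((A * (3 * b + 2) : ℕ) : ℤ) ≤ z 0 + b) → (b : ℤ) + 1 ≤ z 1 ∧ z 1 ≤ 2 * (b : ℤ)} ((· + pt (-1) 0) '' (leftSide ((A * (3 * b + 2) : ℕ) + 1) (3 * b + 1) : Set (Site 2))) ((· + pt (-1) 0) '' (rightSide ((A * (3 * b + 2) : ℕ) + 1) (3 * b + 1) : Set (Site 2))))))) :
    (∀ s : ℕ → ℝ,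
      (∀ n : ℕ, 1 ≤ n →
        ((∃ (μ : ℂ) (v : PlanarRowState (Finset.Icc (0 : ℤ) n) → ℂ),
          (v ≠ 0 ∧ (∀ p, (∃ x, p.1.JoinedToStar x) → v p = 0) ∧
            ∀ p, (∀ x, ¬ p.1.JoinedToStar x) →
              ∑ q, (planarTransfer (Finset.Icc (0 : ℤ) n) p q : ℂ) * v q = μ * v p) ∧
          μ ≠ 1 ∧ ‖μ‖ = s n) ∧
        ∀ (μ : ℂ) (v : PlanarRowState (Finset.Icc (0 : ℤ) n) → ℂ),
          (v ≠ 0 ∧ (∀ p, (∃ x, p.1.JoinedToStar x) → v p = 0) ∧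
            ∀ p, (∀ x, ¬ p.1.JoinedToStar x) →
              ∑ q, (planarTransfer (Finset.Icc (0 : ℤ) n) p q : ℂ) * v q = μ * v p) →
          μ ≠ 1 → ‖μ‖ ≤ s n)) →
      Tendsto (fun n : ℕ ↦ (n : ℝ) * -Real.log (s n)) atTop (𝓝 (2 * Real.pi))) :=
  twoClusterKac_iff_kacTwo.1 fun γ hγ => tendsto_nMul_rateTwo_of_cardyOrderTwo hCO γ hγ

/-! ## §4 The crux from Cardy-order conformal-invariance statements -/

/-- **`StripClusterRates` from `CardyRectangle` (stmt-CriticalPhenomena-4782) and CO₂** (conditional closure of the crux; the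
γ₁-half through leads −1…c4's landed chain `stripClusterRates_of_cardyRectangle_of_kacTwo`). [cite: Cardy1998, eq. (bb)] -/
theorem stripClusterRates_of_cardyRectangle_of_cardyOrderTwo
    (h : Summit.CriticalPhenomena.CardyFormulaZ2.Theses.CardyPolygonWords.CardyRectangle)
    (hCO : (∃ g : ℕ → ℝ, Tendsto (fun A : ℕ ↦ g A / A) atTop (𝓝 (2 * Real.pi)) ∧ ∀ A : ℕ, 1 ≤ A → ∀ᶠ n : ℕ in atTop, (bondPercolation (zdGraph 2) half).real {ω | ∃ x₁ ∈ (leftSide (A * n) n : Set (Site 2)), ∃ y₁ ∈ (rightSide (A * n) n : Set (Site 2)), ∃ x₂ ∈ (leftSide (A * n) n : Set (Site 2)), ∃ y₂ ∈ (rightSide (A * n) n : Set (Site 2)), ω ∈ openConnIn (rectangle (A * n) n : Set (Site 2)) x₁ y₁ ∧ ω ∈ openConnIn (rectangle (A * n) n : Set (Site 2)) x₂ y₂ ∧ ω ∉ openConnIn (rectangle (A * n) n : Set (Site 2)) x₁ x₂} ≤ Real.exp (-g A)) ∧ (∃ G : ℕ → ℝ, Tendsto (fun A : ℕ ↦ G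 A / A) atTop (𝓝 (2 * Real.pi)) ∧ ∀ A : ℕ, 1 ≤ A → ∀ᶠ b : ℕ in atTop, Real.exp (-G A) ≤ (bondPercolation (zdGraph 2) half).real ((openCrossing {z ∈ (rectangle (A * (3 * b + 2) : ℕ) (3 * b + 2) : Set (Site 2)) | (z 0 ≤ (b : ℤ) ∨ ((A * (3 * b + 2) : ℕ) : ℤ) ≤ z 0 + b) → z 1 ≤ (b : ℤ)} (leftSide (A * (3 * b + 2) : ℕ) (3 * b + 2) : Set (Site 2)) (rightSide (A * (3 * b + 2) : ℕ) (3 * b + 2) : Set (Site 2)) ∩ tbCrossing b b ∩ openCrossing {z ∈ (rectangle (A * (3 * b + 2) : ℕ) (3 * b + 2) : Set (Site 2)) | (z 0 ≤ (b : ℤ) ∨ ((A * (3 * b + 2) : ℕ) : ℤ) ≤ z 0 + b) → 2 * (b : ℤ) + 2 ≤ z 1} (leftSide (A * (3 * b + 2) : ℕ) (3 * b + 2) : Set (Site 2)) (rightSide (A * (3 * b + 2) : ℕ) (3 * b + 2) : Set (Site 2)) ∩ (BondConfig.relabel (sym2Equiv (Site.shift (-pt 0 (2 * (b : ℤ) +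 2))))) ⁻¹' tbCrossing b b) ∩ (dualConfig ⁻¹' openCrossing {z ∈ ((· + pt (-1) 0) '' (rectangle ((A * (3 * b + 2) : ℕ) + 1) (3 * b + 1) : Set (Site 2))) | (z 0 ≤ (b : ℤ) ∨ ((A * (3 * b + 2) : ℕ) : ℤ) ≤ z 0 + b) → (b : ℤ) + 1 ≤ z 1 ∧ z 1 ≤ 2 * (b : ℤ)} ((· + pt (-1) 0) '' (leftSide ((A * (3 * b + 2) : ℕ) + 1) (3 * b + 1) : Set (Site 2))) ((· + pt (-1) 0) '' (rightSide ((A * (3 * b + 2) : ℕ) + 1) (3 * b + 1) : Set (Site 2))))))) :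
    Summit.CriticalPhenomena.CardyFormulaZ2.Theses.CardyBoundaryCoulombGas.StripClusterRates :=
  stripClusterRates_of_cardyRectangle_of_kacTwo h (kacTwo_of_cardyOrderTwo hCO)

/-- **`StripClusterRates` from the CONJUNCT and CO₂** (`CardyFormulaZ2 → RectilinearCardy → CardyRectangle`, landed). [cite: Cardy1998, eq. (bb)] -/
theorem stripClusterRates_of_cardyFormulaZ2_of_cardyOrderTwo (h : _root_.CardyFormulaZ2)
    (hCO : (∃ g : ℕ → ℝ, Tendsto (fun A : ℕ ↦ g A / A) atTop (𝓝 (2 * Real.pi)) ∧ ∀ A : ℕ, 1 ≤ A → ∀ᶠ n : ℕ in atTop, (bondPercolation (zdGraph 2) half).real {ω | ∃ x₁ ∈ (leftSide (A * n) n : Set (Site 2)), ∃ y₁ ∈ (rightSide (A * n) n : Set (Site 2)), ∃ x₂ ∈ (leftSide (A * n) n : Set (Site 2)), ∃ y₂ ∈ (rightSide (A * n) n : Set (Site 2)), ω ∈ openConnIn (rectangle (A * n) n : Set (Site 2)) x₁ y₁ ∧ ω ∈ openConnIn (rectangle (A * n) n : Set (Site 2)) x₂ y₂ ∧ ω ∉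 openConnIn (rectangle (A * n) n : Set (Site 2)) x₁ x₂} ≤ Real.exp (-g A)) ∧ (∃ G : ℕ → ℝ, Tendsto (fun A : ℕ ↦ G A / A) atTop (𝓝 (2 * Real.pi)) ∧ ∀ A : ℕ, 1 ≤ A → ∀ᶠ b : ℕ in atTop, Real.exp (-G A) ≤ (bondPercolation (zdGraph 2) half).real ((openCrossing {z ∈ (rectangle (A * (3 * b + 2) : ℕ) (3 * b + 2) : Set (Site 2)) | (z 0 ≤ (b : ℤ) ∨ ((A * (3 * b + 2) : ℕ) : ℤ) ≤ z 0 + b) → z 1 ≤ (b : ℤ)} (leftSide (A * (3 * b + 2) : ℕ) (3 * b + 2) : Set (Site 2)) (rightSide (A * (3 * b + 2) : ℕ) (3 * b + 2) : Set (Site 2)) ∩ tbCrossing b b ∩ openCrossing {z ∈ (rectangle (A * (3 * b + 2) : ℕ) (3 * b + 2) : Set (Site 2)) | (z 0 ≤ (b : ℤ) ∨ ((A * (3 * b + 2) : ℕ) : ℤ) ≤ z 0 + b) → 2 * (b : ℤ) + 2 ≤ z 1} (leftSide (A * (3 * b + 2) : ℕ) (3 * b + 2) : Set (Site 2)) (rightSide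 (A * (3 * b + 2) : ℕ) (3 * b + 2) : Set (Site 2)) ∩ (BondConfig.relabel (sym2Equiv (Site.shift (-pt 0 (2 * (b : ℤ) + 2))))) ⁻¹' tbCrossing b b) ∩ (dualConfig ⁻¹' openCrossing {z ∈ ((· + pt (-1) 0) '' (rectangle ((A * (3 * b + 2) : ℕ) + 1) (3 * b + 1) : Set (Site 2))) | (z 0 ≤ (b : ℤ) ∨ ((A * (3 * b + 2) : ℕ) : ℤ) ≤ z 0 + b) → (b : ℤ) + 1 ≤ z 1 ∧ z 1 ≤ 2 * (b : ℤ)} ((· + pt (-1) 0) '' (leftSide ((A * (3 * b + 2) : ℕ) + 1) (3 * b + 1) : Set (Site 2))) ((· + pt (-1) 0) '' (rightSide ((A * (3 * b + 2) : ℕ) + 1) (3 * b + 1) : Set (Site 2))))))) :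
    Summit.CriticalPhenomena.CardyFormulaZ2.Theses.CardyBoundaryCoulombGas.StripClusterRates :=
  stripClusterRates_of_cardyFormulaZ2_of_kacTwo h (kacTwo_of_cardyOrderTwo hCO)

end Summit.CriticalPhenomena.CardyFormulaZ2.Cruxes.StripClusterRates.TwoClusterRateIsStationaryGap

end
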